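import Literature.Computability.FineGrained.OVFromSETHProgram
import Literature.Computability.FineGrained.OVFromSETH
import Literature.Computability.FineGrained.OneSATProgram
import HarnessLib

/-!
# SETH ⇒ OV (fine-grained.S09): the time and word-size analysis, and the discharge of
# `ovConjectureDet_of_sethWordRAM`

Last part of the proof of the named fact `Literature.Computability.FineGrained.ovConjectureDet_of_sethWordRAM`
(`SETHHardness.lean`; R. Williams, *A new algorithm for optimal 2-constraint satisfaction and its
implications*, TCS 348 (2005), §5.1, Thm. 5.1 — Theorem 5 of the author's version: cooperative subset
queries / orthogonal vectors in `k^{2-ε}` time give CNF-SAT in `2^{(1-ε/2)n}`; V. Vassilevska Williams,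
Proc. ICM 2018, §3, Thm. 3.1: word-RAM SETH implies the OV conjecture, via Impagliazzo–Paturi–Zane
sparsification):

* `OVRed.Single.encodeList_eq_sAll` — Wave0's string encoding of a list of `k`-CNFs is the parser's
  grammar;
* `OVRed.Single.not_ov_outputs_at_wordSize_zero` — an OV program run with word size `0` cannot be
  correct on both a yes- and a no-instance (the degenerate case `kM = 0` of the hypothesis);
* **`OVRed.Single.kSATInRAMTime_of_ovWithDim`** — for `0 < ε ≤ 1` and every `k` there is `c ≥ 1` such
  that an `O(n^{2-ε})` word-RAM algorithm for `OVWithDim c` yields `KSATInRAMTime k (1 - ε/8)`: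
  sparsify with exponent `1/E`, `E = ⌈8/ε⌉`, run the program of `OVFromSETHProgram.lean` at word
  size `wmulK · (n + width)`; the word-size bookkeeping (`OVRed.Single.Params.fits`) and the running
  time (`OVRed.Single.Params.Ttotal_real_le`: `O(2^{(1-ε/4)n} · poly(n))`, absorbed into
  `2^{(1-ε/8)n}`);
* **`ovConjectureDet_of_sethWordRAM_holds`** — the named fact, by contradiction with word-RAM SETH
  at `ε/8` (shrinking `ε` below `1` with `inTimeO_rpow_two_sub_anti`).

This is the single-instance route (namespace `OVRed.Single`); it does not use the split-and-list
facts of `OVFromSETH.lean` (`kSATInRAMTime_of_sparseKSATInRAMTime_serf`,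
`sparseKSATInRAMTime_of_ov_subquadratic`).

## References

* R. Williams, *A new algorithm for optimal 2-constraint satisfaction and its implications*,
  Theoret. Comput. Sci. 348 (2005) 357–365, §5.1 (Thm. 5.1; Theorem 5 of the author's version).
* V. Vassilevska Williams, *On some fine-grained questions in algorithms and complexity*,
  Proc. ICM 2018, §2 (word RAM), §3 Thm. 3.1.
* R. Impagliazzo, R. Paturi, F. Zane, *Which problems have strongly exponential complexity?*,
  JCSS 63 (2001), sparsification lemma (here: `sparsification_holds`).
-/

namespace Literature.Computability.FineGrained.OVRed.Single

open Cryptography Cryptography.WordRAM Cryptography.WordRAM.SProg _root_.Computability Complexity Turing Real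

attribute [local instance] Turing.FinTM2.kFin Turing.FinTM2.ΛFin Turing.FinTM2.σFin
  Turing.FinTM2.Γk₀Fin

/-! ### Wave0's string encoding is the parser's grammar -/

/-- `KCNF.encodeList` is `sAll` of the (variable number, clause list) pairs. [folklore] -/
theorem encodeList_eq_sAll {k : ℕ} (l : List (KCNF k)) :
    KCNF.encodeList l = sAll (l.map fun ψ => (ψ.numVars, ψ.clauses)) := by
  have hlit : ∀ lit : ℕ × Bool, KCNF.encodeLiteral lit = sLit lit := fun lit => by
    simp [KCNF.encodeLiteral, sLit, sBits, encodeNat_eq_natBits]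
  have hcl : ∀ C : List (ℕ × Bool), KCNF.encodeClause C = sClause C := fun C => by
    simp only [KCNF.encodeClause, sClause, List.cons_append, List.cons.injEq, true_and]
    rw [List.flatMap_congr fun lit _ => hlit lit]
  have hf : ∀ ψ : KCNF k, ψ.encode = sFormula (ψ.numVars, ψ.clauses) := fun ψ => by
    simp only [KCNF.encode, sFormula, sBits, encodeNat_eq_natBits]
    rw [List.flatMap_congr fun C _ => hcl C]
  unfold KCNF.encodeList sAll
  rw [List.flatMap_map]
  exact List.flatMap_congr fun ψ _ => by rw [hf]

/-! ### The degenerate case: word size `0` -/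

/-- At word size `0` the initial memory does not depend on the input (of a given length). [folklore] -/
theorem init_zero_eq {y y' : List ℕ} (h : y.length = y'.length) : init 0 y = init 0 y' := by
  unfold init
  simp only [Nat.pow_zero, Nat.mod_one, List.map_const', h]

/-- **An OV program cannot be correct at word size `0`** on both the all-`false` and the all-`true`
instance of `OVWithDim c` with two vectors per side (`c ≥ 1`): both runs start from the same
configuration. [folklore] -/
theorem not_ov_outputs_at_wordSize_zero {c : ℕ} (hc : 1 ≤ c) {Mov : Program} {T : (OVWithDim c).Inst → ℕ}
    (hM : ∀ a, ∃ out ∈ (OVWithDim c).Good a,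
      OutputsWithin Mov (0 * (OVWithDim c).width a) noOracle zeroCoins ((OVWithDim c).encode a) out (T a)) :
    False := by
  have hlog2 : Nat.log 2 2 = 1 := by simpa using Nat.log_pow (b := 2) one_lt_two 1
  have hlog : c = c * Nat.log 2 2 := by rw [hlog2, Nat.mul_one]
  let I₁ : (OVWithDim c).Inst := ⟨⟨2, c, fun _ _ => false, fun _ _ => false⟩, hlog⟩
  let I₂ : (OVWithDim c).Inst := ⟨⟨2, c, fun _ _ => true, fun _ _ => true⟩, hlog⟩
  have h₁ : I₁.1.HasOrthogonalPair := ⟨⟨0, by norm_num⟩, ⟨0, by norm_num⟩, fun j h => by simp at h⟩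
  have h₂ : ¬ I₂.1.HasOrthogonalPair := fun ⟨i, j, h⟩ => h ⟨0, hc⟩ ⟨rfl, rfl⟩
  have hG₁ : (OVWithDim c).Good I₁ = {[1]} := FGProblem.ofPred_good_of_pos _ _ _ _ h₁
  have hG₂ : (OVWithDim c).Good I₂ = {[0]} := FGProblem.ofPred_good_of_neg _ _ _ _ h₂
  obtain ⟨o₁, ho₁, hr₁⟩ := hM I₁
  obtain ⟨o₂, ho₂, hr₂⟩ := hM I₂
  rw [hG₁, Set.mem_singleton_iff] at ho₁
  rw [hG₂, Set.mem_singleton_iff] at ho₂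
  subst ho₁ ho₂
  rw [Nat.zero_mul] at hr₁ hr₂
  have hlen : ((OVWithDim c).encode I₁).length = ((OVWithDim c).encode I₂).length := by
    show (OVInstance.encode ⟨2, c, fun _ _ => false, fun _ _ => false⟩).length =
      (OVInstance.encode ⟨2, c, fun _ _ => true, fun _ _ => true⟩).length
    simp [OVInstance.encode, encodeBoolVec, List.length_flatMap]
  have hr₁' : OutputsWithin Mov 0 noOracle zeroCoins ((OVWithDim c).encode I₂) [1] (T I₁) := by
    unfold OutputsWithin at hr₁ ⊢; rwa [init_zero_eq hlen] at hr₁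
  have := outputsWithin_unique_holds hr₁' hr₂
  simp at this

/-! ### The parameters of a run of the reduction -/

section construction

variable {k E Cs kM : ℕ} (M : TM2ComputableAux Γ' Γ') (Fk : KCNF k → List (KCNF k)) (Ts : ℕ → ℕ → ℕ)

/-- The ghost parameters of the run on the instance `φ` (OV program constants `kM`, `cM`). [folklore] -/
noncomputable def paramsOf (k E Cs kM cM : ℕ) (M : TM2ComputableAux Γ' Γ') (Fk : KCNF k → List (KCNF k))
    (Ts : ℕ → ℕ → ℕ) (φ : CNF ℕ) (hw : φ.IsWidthLE k) : Params :=
  ⟨φ, k, E, Cs, kM, cM, M, (Fk (toKCNF k φ hw)).map fun ψ => (ψ.numVars, ψ.clauses),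
    Ts φ.numVars (KCNF.encode (toKCNF k φ hw)).length⟩

end construction

/-! ### The word size -/

/-- The constant of the bound `|y| ≤ A_y · 2^{3n}`, from `E` and `Cs`. [folklore] -/
def AyK (E Cs : ℕ) : ℕ := 2 + 2 ^ (E + 2) * ((2 * Cs + 3) * (E + 2))

/-- The constant of the bound on the top of the memory. [folklore] -/
def AtopK (k E Cs kM cM κ ct mpb : ℕ) : ℕ :=
  (3 * k + 112) * 2 ^ (k + 3) + 2 * (2 ^ (Nat.size (AyK E Cs) * kM) + cM + AyK E Cs) + 4 + κ +
    κ * ((k + 5) * 2 ^ (k + 3) + ct * 1 * ((k + 5) * 2 ^ (k + 3)) ^ ct * mpb + (2 + 2 * Cs + 3 * Cs * k)) + κ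

/-- The exponent of that bound. [folklore] -/
def GtopK (k kM ct : ℕ) : ℕ := 3 * kM + 3 + (k + 3) * (ct + 1) + 3

/-- **The word-size multiplier** of the program, from the constants of the reduction only. [folklore] -/
noncomputable def wmulK (k E Cs kM cM : ℕ) (M : TM2ComputableAux Γ' Γ') (ct : ℕ) : ℕ :=
  (GtopK k kM ct + Nat.size (AtopK k E Cs kM cM (TM2Emu.enc M.tm).κ ct (Complexity.TM2Comp.machinePushBound M.tm))) +
    ((k + 3) + Nat.size (2 * ((k + 3) * 2 ^ (k + 3)) + 200)) +
    (Nat.size ((TM2Emu.enc M.tm).γ + 1) + 1) + (Nat.size (TM2Emu.keyBound M.tm) + 1) +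
    ((Nat.size (AyK E Cs) + 3) * kM + 1) + (Nat.size (E + 4) + 1) + 1

namespace Params

variable (p : Params)

/-- A bound of the shape `A · 2^{G n}`. [folklore] -/
def EB (X A G : ℕ) : Prop := X ≤ A * 2 ^ (G * p.n)

variable {p}

/-- Bounds of exponential shape add. [folklore] -/
theorem EB.add {X Y A B G : ℕ} (hX : p.EB X A G) (hY : p.EB Y B G) : p.EB (X + Y) (A + B) G := by
  unfold EB at *; rw [Nat.add_mul]; omega

/-- Bounds of exponential shape multiply. [folklore] -/
theorem EB.mul {X Y A B G G' : ℕ} (hX : p.EB X A G) (hY : p.EB Y B G') : p.EB (X * Y) (A * B) (G + G') := by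
  unfold EB at *
  calc X * Y ≤ (A * 2 ^ (G * p.n)) * (B * 2 ^ (G' * p.n)) := Nat.mul_le_mul hX hY
    _ = A * B * 2 ^ ((G + G') * p.n) := by rw [Nat.add_mul, Nat.pow_add]; ring

/-- Raising the exponent. [folklore] -/
theorem EB.mono {X A G A' G' : ℕ} (hX : p.EB X A G) (hA : A ≤ A') (hG : G ≤ G') : p.EB X A' G' := by
  unfold EB at *
  exact hX.trans (Nat.mul_le_mul hA (Nat.pow_le_pow_right (by norm_num) (Nat.mul_le_mul_right _ hG)))

/-- Constants. [folklore] -/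
theorem EB.const (A G : ℕ) : p.EB A A G := by
  unfold EB; exact Nat.le_mul_of_pos_right _ (Nat.two_pow_pos _)

/-- From a bound, a smaller quantity. [folklore] -/
theorem EB.of_le {X Y A G : ℕ} (hY : p.EB Y A G) (h : X ≤ Y) : p.EB X A G := le_trans h hY

/-- `2 ^ (size X)` under a bound of exponential shape. [folklore] -/
theorem EB.two_pow_size {X A G : ℕ} (hX : p.EB X A G) : p.EB (2 ^ Nat.size X) (2 ^ Nat.size A) G := by
  unfold EB at *
  have := Nat.size_le_size hX
  rw [← Nat.shiftLeft_eq] at this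
  rcases Nat.eq_zero_or_pos A with rfl | hA
  · simp at hX; subst hX; simpa using Nat.one_le_two_pow
  rw [Nat.size_shiftLeft (by omega)] at this
  calc 2 ^ Nat.size X ≤ 2 ^ (Nat.size A + G * p.n) := Nat.pow_le_pow_right (by norm_num) this
    _ = 2 ^ Nat.size A * 2 ^ (G * p.n) := by rw [Nat.pow_add]

/-- `2 ^ (m · size X)` under a bound of exponential shape. [folklore] -/
theorem EB.two_pow_mul_size {X A G : ℕ} (hX : p.EB X A G) (m : ℕ) :
    p.EB (2 ^ (Nat.size X * m)) (2 ^ (Nat.size A * m)) (G * m) := by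
  have h := hX.two_pow_size
  unfold EB at *
  calc 2 ^ (Nat.size X * m) = (2 ^ Nat.size X) ^ m := by rw [Nat.pow_mul]
    _ ≤ (2 ^ Nat.size A * 2 ^ (G * p.n)) ^ m := Nat.pow_le_pow_left h _
    _ = 2 ^ (Nat.size A * m) * 2 ^ (G * m * p.n) := by
        rw [Nat.mul_pow, ← Nat.pow_mul, ← Nat.pow_mul]; congr 1; ring_nf

/-- Powers under a bound of exponential shape. [folklore] -/
theorem EB.pow {X A G : ℕ} (hX : p.EB X A G) : ∀ m : ℕ, p.EB (X ^ m) (A ^ m) (G * m)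
  | 0 => by unfold EB; simp
  | m + 1 => by
    have := (EB.pow hX m).mul hX
    rw [Nat.pow_succ, Nat.pow_succ]
    refine this.mono le_rfl (le_of_eq ?_)
    ring

/-- A bound of exponential shape fits in `(G + size A) (n + 1)` bits. [folklore] -/
theorem EB.lt_two_pow {X A G : ℕ} (hX : p.EB X A G) {W : ℕ} (hW : (G + Nat.size A) * (p.n + 1) ≤ W) :
    X < 2 ^ W := by
  unfold EB at hX
  have h1 : A * 2 ^ (G * p.n) < 2 ^ (Nat.size A + G * p.n) := by
    rw [Nat.pow_add]; exact Nat.mul_lt_mul_of_lt_of_le (Nat.lt_size_self A) le_rfl (Nat.two_pow_pos _)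
  refine lt_of_le_of_lt hX (lt_of_lt_of_le h1 (Nat.pow_le_pow_right (by norm_num) (le_trans ?_ hW)))
  have : (G + Nat.size A) * (p.n + 1) = G * p.n + G + Nat.size A * p.n + Nat.size A := by ring
  rw [this]; omega

variable (p)

/-- The constant of the bound on the emulated input length `|y| ≤ A_y · 2^{3n}` (as a function of the
parameters `E`, `Cs` only). [folklore] -/
def Ay : ℕ := AyK p.E p.Cs

/-- The polynomial scale `(2(n+1))^{k+3}`. [folklore] -/
def P : ℕ := scaleP p.n p.k

/-- **The elementary bounds of a run** in exponential shape (all with the one exponent `G₀`). [folklore] -/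
def G₀ (ct : ℕ) : ℕ := 3 * p.kM + 3 + (p.k + 3) * (ct + 1) + 1

/-- The scale is of exponential shape. [folklore] -/
theorem EB_P : p.EB p.P (2 ^ (p.k + 3)) (p.k + 3) := by
  unfold EB P
  calc scaleP p.n p.k ≤ 2 ^ ((p.k + 3) * (p.n + 1)) := scaleP_le_two_pow _ _
    _ = 2 ^ (p.k + 3) * 2 ^ ((p.k + 3) * p.n) := by rw [← Nat.pow_add]; congr 1; ring

/-- `ℓ ≤ n + E + 1`, `ℓ - 1 ≤ n` (for `E ≥ 1`), `hh ≤ n`, `Lg ≤ 2 n + E + 1`. [folklore] -/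
theorem ℓ_hh_Lg_le : p.ℓ ≤ p.n + p.E + 1 ∧ (1 ≤ p.E → p.ℓ - 1 ≤ p.n) ∧ p.hh ≤ p.n ∧ p.Lg ≤ 2 * p.n + p.E + 1 := by
  have h0 : 1 ≤ p.E → p.ℓ - 1 ≤ p.n := fun hE => by
    unfold ℓ
    rw [Nat.add_sub_cancel]
    have h1 : p.n ≤ p.n * p.E := Nat.le_mul_of_pos_right _ hE
    have h2 : (p.n + (p.E - 1)) / p.E < p.n + 1 :=
      (Nat.div_lt_iff_lt_mul hE).2 (by rw [Nat.add_mul, Nat.one_mul]; omega)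
    omega
  have h1 : p.ℓ ≤ p.n + p.E + 1 := by
    rcases Nat.eq_zero_or_pos p.E with hE | hE
    · unfold ℓ; rw [hE]; simp
    · have := h0 hE; omega
  have h2 : p.hh ≤ p.n := by unfold hh; omega
  exact ⟨h1, h0, h2, by unfold Lg; omega⟩

/-- `N ≤ 2^{E+1} · 2^{2n}`. [folklore] -/
theorem EB_N : p.EB p.N (2 ^ (p.E + 1)) 2 := by
  obtain ⟨-, -, -, hLg⟩ := p.ℓ_hh_Lg_le
  unfold EB N
  calc 2 ^ p.Lg ≤ 2 ^ (2 * p.n + p.E + 1) := Nat.pow_le_pow_right (by norm_num) hLg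
    _ = 2 ^ (p.E + 1) * 2 ^ (2 * p.n) := by rw [← Nat.pow_add]; congr 1; omega

/-- `d ≤ c (E + 2) · 2^n`. [folklore] -/
theorem EB_d : p.EB p.d (p.c * (p.E + 2)) 1 := by
  obtain ⟨-, -, -, hLg⟩ := p.ℓ_hh_Lg_le
  have hn : p.n + 1 ≤ 2 ^ p.n := Nat.lt_two_pow_self
  unfold EB d
  calc p.Lg * p.c ≤ (2 * p.n + p.E + 1) * p.c := Nat.mul_le_mul_right _ hLg
    _ ≤ ((p.E + 2) * (p.n + 1)) * p.c := Nat.mul_le_mul_right _ (by nlinarith)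
    _ ≤ ((p.E + 2) * 2 ^ p.n) * p.c := Nat.mul_le_mul_right _ (Nat.mul_le_mul_left _ hn)
    _ = p.c * (p.E + 2) * 2 ^ (1 * p.n) := by rw [Nat.one_mul]; ring

/-- `|y| ≤ A_y · 2^{3n}`. [folklore] -/
theorem EB_ylen : p.EB p.ylen p.Ay 3 := by
  have h1 : p.EB (2 * p.Nd) (2 * (2 ^ (p.E + 1) * (p.c * (p.E + 2)))) 3 := by
    have := (EB.const (p := p) 2 0).mul (p.EB_N.mul p.EB_d)
    exact this
  have h2 : p.EB 2 2 3 := EB.const 2 3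
  have := h2.add h1
  unfold ylen
  refine this.mono (le_of_eq ?_) le_rfl
  unfold Ay AyK c; ring

/-- `Pw ≤ 2^{size A_y · kM} · 2^{3 kM n}`. [folklore] -/
theorem EB_Pw : p.EB p.Pw (2 ^ (Nat.size p.Ay * p.kM)) (3 * p.kM) := by
  have := p.EB_ylen.two_pow_mul_size p.kM
  unfold Pw ws szy; exact this

end Params

/-! ### The output of the sparsifier -/

/-- The length of the output string: each formula contributes its encoding and a blank. [folklore] -/
theorem length_sAll_le {k C n : ℕ} (l : List (KCNF k)) (hn : ∀ ψ ∈ l, ψ.numVars = n)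
    (hC : ∀ ψ ∈ l, ψ.clauses.length ≤ C * n) :
    (sAll (l.map fun ψ => (ψ.numVars, ψ.clauses))).length ≤ l.length * ((2 + 2 * C + 3 * C * k) * (n + 1) ^ 2) := by
  rw [← encodeList_eq_sAll]
  induction l with
  | nil => simp [KCNF.encodeList]
  | cons ψ l ih =>
    have h1 := KCNF.length_encode_succ_le_of_sparse ψ (by rw [hn ψ (by simp)]; exact hC ψ (by simp))
    rw [hn ψ (by simp)] at h1
    have h2 := ih (fun ψ' h => hn ψ' (by simp [h])) (fun ψ' h => hC ψ' (by simp [h]))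
    simp only [KCNF.encodeList, List.flatMap_cons, List.length_append, List.length_cons,
      List.length_nil] at h2 ⊢
    rw [Nat.succ_mul]
    omega

/-! ### The time of the parser, polynomially -/

/-- **The uniform time of one formula** is `O((n+1)² · H)`: `TformulaK kw + 2 ≤ (Cs+1)(44 kw + 65)(n+1)² H`
when `D ≤ n · Cs` and `H ≥ 1`. [folklore] -/
theorem TformulaK_le (g : BP) {Cs kw : ℕ} (hD : g.D ≤ g.n * Cs) (hH : 1 ≤ g.H) :
    g.TformulaK kw + 2 ≤ (Cs + 1) * (44 * kw + 65) * (g.n + 1) ^ 2 * g.H := by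
  have hsz : Nat.size g.n ≤ g.n := Nat.size_le.2 Nat.lt_two_pow_self
  have eL : g.TlitK + 2 = 11 * Nat.size g.n + 9 * g.H + 24 := by unfold BP.TlitK; omega
  have eC : g.TclauseK kw + 2 = kw * (g.TlitK + 2) + 10 * g.H + 18 := by unfold BP.TclauseK; omega
  have eF : g.TformulaK kw + 2 = g.D * (g.TclauseK kw + 2) + 5 * g.H + 11 * Nat.size g.n + 21 := by
    unfold BP.TformulaK; omega
  have hnH : g.n ≤ g.n * g.H := Nat.le_mul_of_pos_right _ hH
  have bL : g.TlitK + 2 ≤ (11 * g.n + 33) * g.H := by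
    have e : (11 * g.n + 33) * g.H = 11 * (g.n * g.H) + 33 * g.H := by ring
    rw [eL, e]; omega
  have bC : g.TclauseK kw + 2 ≤ (kw * (11 * g.n + 33) + 28) * g.H := by
    have h1 := Nat.mul_le_mul_left kw bL
    have e : (kw * (11 * g.n + 33) + 28) * g.H = kw * ((11 * g.n + 33) * g.H) + 28 * g.H := by ring
    rw [eC, e]; omega
  have bF : g.TformulaK kw + 2 ≤ (g.D * (kw * (11 * g.n + 33) + 28) + 11 * g.n + 26) * g.H := by
    have h1 := Nat.mul_le_mul_left g.D bC
    have e : (g.D * (kw * (11 * g.n + 33) + 28) + 11 * g.n + 26) * g.H =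
        g.D * ((kw * (11 * g.n + 33) + 28) * g.H) + 11 * (g.n * g.H) + 26 * g.H := by ring
    rw [eF, e]; omega
  refine bF.trans (Nat.mul_le_mul_right _ ?_)
  set n := g.n
  have hK : g.D * (kw * (11 * n + 33) + 28) ≤ n * Cs * (kw * (11 * n + 33) + 28) := Nat.mul_le_mul_right _ hD
  have m1 : n ^ 2 ≤ (n + 1) ^ 2 := Nat.pow_le_pow_left (Nat.le_succ _) _
  have m2 : n ≤ (n + 1) ^ 2 := by nlinarith
  have m3 : 1 ≤ (n + 1) ^ 2 := Nat.one_le_pow _ _ (Nat.succ_pos _)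
  have t1 := Nat.mul_le_mul_left (11 * Cs * kw) m1
  have t2 := Nat.mul_le_mul_left (33 * Cs * kw) m2
  have t3 := Nat.mul_le_mul_left (28 * Cs) m2
  have t4 := Nat.mul_le_mul_left 11 m2
  have t5 := Nat.mul_le_mul_left 26 m3
  have eK : n * Cs * (kw * (11 * n + 33) + 28) + 11 * n + 26 =
      11 * Cs * kw * n ^ 2 + 33 * Cs * kw * n + 28 * Cs * n + 11 * n + 26 * 1 := by ring
  have eR : (Cs + 1) * (44 * kw + 65) * (n + 1) ^ 2 = 11 * Cs * kw * (n + 1) ^ 2 + 33 * Cs * kw * (n + 1) ^ 2 +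
      28 * Cs * (n + 1) ^ 2 + 11 * (n + 1) ^ 2 + 26 * (n + 1) ^ 2 + (37 * Cs + 44 * kw + 28) * (n + 1) ^ 2 := by ring
  omega

namespace Params

variable (p : Params)

/-! ### All quantities fit in the word -/

/-- The constant of the bound on the top of the memory, for a machine time `≤ ct · 2ⁿ · (Y+1)^{ct}` and
`mpb` pushes per step. [folklore] -/
noncomputable def Atop (ct mpb : ℕ) : ℕ := AtopK p.k p.E p.Cs p.kM p.cM p.κ ct mpb

/-- The exponent of that bound. [folklore] -/
def Gtop (ct : ℕ) : ℕ := GtopK p.k p.kM ct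

/-- **The word-size multiplier** of the program (word size `wmul · (n + width)`). [folklore] -/
noncomputable def wmul (ct : ℕ) : ℕ := wmulK p.k p.E p.Cs p.kM p.cM p.M ct

/-- **The word size fits** (`hT`: the machine's time; `hout`: the output length; no repeated clauses). [folklore] -/
theorem fits (hw : p.φ.IsWidthLE p.k) (hnd : p.φ.Nodup) {ct : ℕ}
    (hT : p.T' ≤ ct * 2 ^ (1 * p.n) * (p.Y + 1) ^ ct)
    (hout : p.out.length ≤ 2 ^ p.n * ((2 + 2 * p.Cs + 3 * p.Cs * p.k) * (p.n + 1) ^ 2)) :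
    p.Fits (p.wmul ct * (p.n + inputWidth p.x)) := by
  set width := inputWidth p.x with hwid
  set W := p.wmul ct * (p.n + width) with hW
  have hw1 : 1 ≤ width := inputWidth_pos _
  have hWge : ∀ q, q ≤ p.wmul ct → q * (p.n + 1) ≤ W := fun q hq =>
    Nat.mul_le_mul hq (by omega)
  obtain ⟨hL, hY, -⟩ := kSAT_size_bounds hw hnd (icodes p.M)
  have hL' : p.L ≤ (p.k + 3) * p.P := hL
  have hY' : p.Y + 1 ≤ (p.k + 5) * p.P := hY
  have hP1 : 1 ≤ p.P := Nat.one_le_pow _ _ (by omega)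
  -- the elementary bounds, all raised to the exponent `Gtop`
  have eP := p.EB_P
  have eL : p.EB p.L ((p.k + 3) * 2 ^ (p.k + 3)) (p.k + 3) := by
    have := (EB.const (p := p) (p.k + 3) 0).mul eP
    simp only [Nat.zero_add] at this
    exact this.of_le hL'
  have eY : p.EB (p.Y + 1) ((p.k + 5) * 2 ^ (p.k + 3)) (p.k + 3) := by
    have := (EB.const (p := p) (p.k + 5) 0).mul eP
    simp only [Nat.zero_add] at this
    exact this.of_le hY'
  have eBv : p.EB p.Bv ((3 * p.k + 112) * 2 ^ (p.k + 3)) (p.k + 3) := by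
    have := (EB.const (p := p) (3 * p.k + 112) 0).mul eP
    simp only [Nat.zero_add] at this
    refine this.of_le ?_
    have e : (3 * p.k + 112) * p.P = 2 * ((p.k + 3) * p.P) + (p.k + 5) * p.P + 101 * p.P := by ring
    rw [e]; unfold Bv; omega
  have eV : p.EB p.V (2 ^ (Nat.size p.Ay * p.kM) + p.cM + p.Ay) (3 * p.kM + 3) := by
    have h1 := p.EB_Pw.mono le_rfl (show 3 * p.kM ≤ 3 * p.kM + 3 by omega)
    have h2 := (EB.const (p := p) p.cM 0).mono le_rfl (show 0 ≤ 3 * p.kM + 3 by omega)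
    have h3 := p.EB_ylen.mono le_rfl (show 3 ≤ 3 * p.kM + 3 by omega)
    exact ((h1.add h2).add h3).of_le (by unfold V; omega)
  have eQ : p.EB p.Qtm ((3 * p.k + 112) * 2 ^ (p.k + 3) + 2 * (2 ^ (Nat.size p.Ay * p.kM) + p.cM + p.Ay) + 4)
      (p.Gtop ct) := by
    have h1 := eBv.mono le_rfl (show p.k + 3 ≤ p.Gtop ct by unfold Gtop GtopK; nlinarith)
    have h2 := eV.mono le_rfl (show 3 * p.kM + 3 ≤ p.Gtop ct by unfold Gtop GtopK; omega)
    have h3 : p.EB (2 * p.V) (2 * (2 ^ (Nat.size p.Ay * p.kM) + p.cM + p.Ay)) (p.Gtop ct) := by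
      have := (EB.const (p := p) 2 0).mul h2; simpa using this
    have h4 := (EB.const (p := p) 4 (p.Gtop ct))
    exact ((h1.add h3).add h4).of_le (by unfold Qtm Sv; omega)
  have eT : p.EB p.T' (ct * 1 * ((p.k + 5) * 2 ^ (p.k + 3)) ^ ct) (0 + 1 + (p.k + 3) * ct) := by
    have h2n : p.EB (2 ^ (1 * p.n)) 1 1 := by unfold EB; omega
    exact (((EB.const (p := p) ct 0).mul h2n).mul (eY.pow ct)).of_le hT
  have ehb : p.EB p.hb ((p.k + 5) * 2 ^ (p.k + 3) + ct * 1 * ((p.k + 5) * 2 ^ (p.k + 3)) ^ ct *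
      Complexity.TM2Comp.machinePushBound p.M.tm) (p.Gtop ct) := by
    have h1 := eY.mono le_rfl (show p.k + 3 ≤ p.Gtop ct by unfold Gtop GtopK; nlinarith)
    have h2 := (eT.mul (EB.const (p := p) (Complexity.TM2Comp.machinePushBound p.M.tm) 0)).mono le_rfl
      (show 0 + 1 + (p.k + 3) * ct + 0 ≤ p.Gtop ct by unfold Gtop GtopK; nlinarith)
    refine (h1.add h2).of_le ?_
    unfold hb TM2Emu.heightBound; omega
  have eout : p.EB p.out.length (2 + 2 * p.Cs + 3 * p.Cs * p.k) (p.Gtop ct) := by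
    refine EB.mono ?_ le_rfl (show 3 ≤ p.Gtop ct by unfold Gtop GtopK; omega)
    unfold EB
    have hsq : (p.n + 1) ^ 2 ≤ 2 ^ (2 * p.n) := by
      rw [Nat.mul_comm 2, Nat.pow_mul]; exact Nat.pow_le_pow_left Nat.lt_two_pow_self _
    calc p.out.length ≤ 2 ^ p.n * ((2 + 2 * p.Cs + 3 * p.Cs * p.k) * (p.n + 1) ^ 2) := hout
      _ ≤ 2 ^ p.n * ((2 + 2 * p.Cs + 3 * p.Cs * p.k) * 2 ^ (2 * p.n)) := by gcongr
      _ = (2 + 2 * p.Cs + 3 * p.Cs * p.k) * 2 ^ (3 * p.n) := by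
          rw [show 3 * p.n = p.n + 2 * p.n by ring, Nat.pow_add]; ring
  have etop : p.EB (cellAddr p.Qtm p.κ p.κ (max p.hb p.out.length))
      (p.Atop ct (Complexity.TM2Comp.machinePushBound p.M.tm)) (p.Gtop ct) := by
    have hκ := EB.const (p := p) p.κ (p.Gtop ct)
    have hm : p.EB (max p.hb p.out.length) _ (p.Gtop ct) := (ehb.add eout).of_le (max_le (by omega) (by omega))
    have := (((eQ.add hκ).add ((EB.const (p := p) p.κ 0).mul hm |>.mono le_rfl (by omega))).add hκ)
    refine this.of_le ?_ |>.mono (le_of_eq ?_) le_rfl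
    · unfold cellAddr; exact le_rfl
    · unfold Atop AtopK Ay κ; ring
  -- the requirements
  refine ⟨?_, ?_, ?_, ?_, ?_, ?_, ?_⟩
  · -- width
    calc width = 1 * width := (Nat.one_mul _).symm
      _ ≤ p.wmul ct * (p.n + width) := Nat.mul_le_mul (by unfold wmul wmulK; omega) (Nat.le_add_left _ _)
  · -- reloc
    have e : p.EB (2 * p.L + 200) (2 * ((p.k + 3) * 2 ^ (p.k + 3)) + 200) (p.k + 3) := by
      have := ((EB.const (p := p) 2 0).mul eL).add (EB.const (p := p) 200 (0 + (p.k + 3)))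
      simpa using this
    refine e.lt_two_pow (hWge _ ?_)
    simp only [wmul, wmulK]; omega
  · refine etop.lt_two_pow (hWge _ ?_)
    simp only [wmul, wmulK, Gtop, Atop, Params.κ]; omega
  · have e := EB.const (p := p) ((TM2Emu.enc p.M.tm).γ + 1) 0
    refine e.lt_two_pow (hWge _ ?_)
    simp only [wmul, wmulK]; omega
  · have e := EB.const (p := p) (TM2Emu.keyBound p.M.tm) 0
    refine e.lt_two_pow (hWge _ ?_)
    simp only [wmul, wmulK]; omega
  · -- ws < W
    have hsz : p.szy ≤ Nat.size p.Ay + 3 * p.n := by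
      have h := p.EB_ylen
      unfold EB at h
      unfold szy
      have := Nat.size_le_size h
      rw [← Nat.shiftLeft_eq, Nat.size_shiftLeft (by unfold Ay AyK; positivity)] at this
      omega
    have h1 : p.ws ≤ (Nat.size p.Ay + 3) * p.kM * (p.n + 1) := by
      unfold ws
      have e1 : (Nat.size p.Ay + 3 * p.n) * p.kM = Nat.size p.Ay * p.kM + 3 * (p.n * p.kM) := by ring
      have e2 : (Nat.size p.Ay + 3) * p.kM * (p.n + 1) =
          Nat.size p.Ay * p.kM * p.n + Nat.size p.Ay * p.kM + 3 * (p.n * p.kM) + 3 * p.kM := by ring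
      have h := Nat.mul_le_mul_right p.kM hsz
      rw [e1] at h; rw [e2]; omega
    have h2 := hWge ((Nat.size p.Ay + 3) * p.kM + 1) (by simp only [wmul, wmulK, Ay]; omega)
    have e3 : ((Nat.size p.Ay + 3) * p.kM + 1) * (p.n + 1) = (Nat.size p.Ay + 3) * p.kM * (p.n + 1) + (p.n + 1) := by
      ring
    rw [e3] at h2
    omega
  · -- n bound
    have e : p.EB (2 * p.n + p.E + 2) (p.E + 4) 1 := by
      unfold EB
      have h1 : (p.E + 4) * (p.n + 1) ≤ (p.E + 4) * 2 ^ p.n := Nat.mul_le_mul_left _ Nat.lt_two_pow_self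
      have e1 : (p.E + 4) * (p.n + 1) = p.E * p.n + p.E + 4 * p.n + 4 := by ring
      rw [Nat.one_mul]; rw [e1] at h1; omega
    refine e.lt_two_pow (hWge _ ?_)
    simp only [wmul, wmulK]; omega

/-! ### The running time -/

/-- The constant of the polynomial part of the build. [folklore] -/
noncomputable def Kpoly : ℕ := 41 * p.k + 12 * p.Ay + TM2Emu.bootCost p.M.tm + 400

/-- **The build time, piece by piece**: polynomial part, the simulation, the initialisation, the parser.
[folklore] -/
theorem Tpre_le (hw : p.φ.IsWidthLE p.k) (hnd : p.φ.Nodup) :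
    p.Tpre p.k ≤ p.Kpoly * p.P + p.T' * ((TM2Emu.enc p.M.tm).stepCost p.M.tm.m + 2) +
      p.N * ((17 * p.E + 37) * (p.n + 1)) + p.Fs.length * ((p.Cs + 1) * (44 * p.k + 65) * (p.n + 1) ^ 2 * p.H) := by
  obtain ⟨hL, hY, htr⟩ := kSAT_size_bounds hw hnd (icodes p.M)
  obtain ⟨hℓ1, -, hN1, hHN, hd1, -⟩ := p.small_facts
  obtain ⟨hℓ, -, -⟩ := p.ℓ_hh_Lg_le
  have hP1 : 1 ≤ p.P := Nat.one_le_pow _ _ (by omega)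
  have hnP : p.n + 1 ≤ p.P := (scaleP_facts p.n p.k (m := 0) (by positivity)).2.1
  have hsz : p.szy ≤ p.Ay + 3 * p.n := by
    have h := p.EB_ylen
    unfold EB at h
    unfold szy
    have := Nat.size_le_size h
    rw [← Nat.shiftLeft_eq, Nat.size_shiftLeft (by unfold Ay AyK; positivity)] at this
    have := Nat.size_le.2 (Nat.lt_two_pow_self (n := p.Ay))
    omega
  have hparse : p.bp.Tparse p.k p.Fs.length ≤ 7 + p.Fs.length * ((p.Cs + 1) * (44 * p.k + 65) * (p.n + 1) ^ 2 * p.H) := by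
    unfold BP.Tparse
    have := Nat.mul_le_mul_left p.Fs.length
      (TformulaK_le p.bp (Cs := p.Cs) (kw := p.k) (le_of_eq rfl) (show 1 ≤ p.H from Nat.one_le_two_pow))
    change p.Fs.length * (p.bp.TformulaK p.k + 2) ≤ p.Fs.length * ((p.Cs + 1) * (44 * p.k + 65) * (p.n + 1) ^ 2 * p.H) at this
    omega
  have hinit : p.bp.Tinit ≤ p.N * ((17 * p.E + 37) * (p.n + 1)) + 16 := by
    unfold BP.Tinit
    show p.N * (17 * p.ℓ + 20) + 16 ≤ _
    have : 17 * p.ℓ + 20 ≤ (17 * p.E + 37) * (p.n + 1) := by nlinarith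
    have := Nat.mul_le_mul_left p.N this
    omega
  -- linear bookkeeping, with the products as atoms
  have hL₀ : p.L ≤ (p.k + 3) * p.P := hL
  have hY₀ : p.Y + 1 ≤ (p.k + 5) * p.P := hY
  have htr₀ : KSatTranscoder.transcodeTime p.φ ≤ (35 + 25 * p.k) * p.P := htr
  have eP : (p.k + 3) * p.P = p.k * p.P + 3 * p.P := by ring
  have eY : (p.k + 5) * p.P = p.k * p.P + 5 * p.P := by ring
  have eT : (35 + 25 * p.k) * p.P = 25 * (p.k * p.P) + 35 * p.P := by ring
  have eK : p.Kpoly * p.P = 41 * (p.k * p.P) + 12 * (p.Ay * p.P) + TM2Emu.bootCost p.M.tm * p.P + 400 * p.P := by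
    unfold Kpoly; ring
  have hAyP : p.Ay ≤ p.Ay * p.P := Nat.le_mul_of_pos_right _ hP1
  have hbootP : TM2Emu.bootCost p.M.tm ≤ TM2Emu.bootCost p.M.tm * p.P := Nat.le_mul_of_pos_right _ hP1
  rw [eP] at hL₀; rw [eY] at hY₀; rw [eT] at htr₀
  rw [eK]
  unfold Tpre Tsetup Tsim
  omega

/-! ### The running time, in real terms -/

/-- The constant of the time bound, from the constants of the reduction only. [folklore] -/
noncomputable def _root_.Literature.Computability.FineGrained.OVRed.Single.KrealK (k E Cs : ℕ) (M : TM2ComputableAux Γ' Γ')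
    (ct : ℕ) (Cov C₁ : ℝ) : ℝ :=
  (((41 * k + 12 * AyK E Cs + TM2Emu.bootCost M.tm + 400 : ℕ) : ℝ) * 2 ^ (k + 3) +
    (((TM2Emu.enc M.tm).stepCost M.tm.m + 2 : ℕ) : ℝ) * ct * ((k : ℝ) + 5) ^ ct * 2 ^ ((k + 3) * ct) +
    6 * (17 * (E : ℝ) + 37) + 2 * (((Cs + 1) * (44 * k + 65) : ℕ) : ℝ) + 1368 * Cov) * C₁ + 38 * Cov + 4

/-- The constant of the time bound of a run. [folklore] -/
noncomputable def Kreal (ct : ℕ) (Cov C₁ : ℝ) : ℝ := KrealK p.k p.E p.Cs p.M ct Cov C₁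

/-- `⌊a⌋₊ ≤ max a 0`. [folklore] -/
theorem _root_.Literature.Computability.FineGrained.OVRed.Single.natFloor_le_max (a : ℝ) : ((⌊a⌋₊ : ℕ) : ℝ) ≤ max a 0 := by
  rcases le_or_gt 0 a with h | h
  · exact (Nat.floor_le h).trans (le_max_left _ _)
  · rw [Nat.floor_of_nonpos h.le]; simp

/-- `N ≤ 2^{5/2} · 2^{(1/E + 1/2) n} ≤ 6 · 2^{(1/E + 1/2) n}`. [folklore] -/
theorem N_real_le (hE0 : (0 : ℝ) < p.E) :
    (p.N : ℝ) ≤ 6 * (2 : ℝ) ^ (((p.E : ℝ)⁻¹ + 1 / 2) * p.n) := by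
  obtain ⟨-, -, -, -, -, -, hHeq, hNeq, hLgeq⟩ := p.small_facts
  have hℓr : (p.ℓ : ℝ) ≤ (p.n : ℝ) / p.E + 2 := by
    have h1 : (((p.n + (p.E - 1)) / p.E : ℕ) : ℝ) ≤ ((p.n + (p.E - 1) : ℕ) : ℝ) / p.E := Nat.cast_div_le
    have h2 : ((p.n + (p.E - 1) : ℕ) : ℝ) / p.E ≤ (p.n : ℝ) / p.E + 1 := by
      rw [div_add_one hE0.ne', div_le_div_iff_of_pos_right hE0]; push_cast
      have : ((p.E - 1 : ℕ) : ℝ) ≤ p.E := by exact_mod_cast Nat.sub_le _ _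
      linarith
    unfold ℓ; push_cast; linarith
  have hhr : (p.hh : ℝ) ≤ ((p.n : ℝ) + 1) / 2 := by
    unfold hh
    calc (((p.n + 1) / 2 : ℕ) : ℝ) ≤ ((p.n + 1 : ℕ) : ℝ) / 2 := Nat.cast_div_le
      _ = ((p.n : ℝ) + 1) / 2 := by push_cast; ring
  have hLgr : (p.Lg : ℝ) ≤ ((p.E : ℝ)⁻¹ + 1 / 2) * p.n + 5 / 2 := by
    rw [hLgeq]; push_cast
    have : (p.n : ℝ) / p.E = (p.E : ℝ)⁻¹ * p.n := by rw [div_eq_inv_mul]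
    linarith
  have hN : (p.N : ℝ) = (2 : ℝ) ^ (p.Lg : ℝ) := by rw [hNeq]; push_cast; rw [Real.rpow_natCast]
  have h6 : (2 : ℝ) ^ ((5 : ℝ) / 2) ≤ 6 := by
    have hs : Real.sqrt 2 ≤ 3 / 2 := by
      calc Real.sqrt 2 ≤ Real.sqrt ((3 / 2) ^ 2) := Real.sqrt_le_sqrt (by norm_num)
        _ = 3 / 2 := Real.sqrt_sq (by norm_num)
    have h22 : (2 : ℝ) ^ ((5 : ℝ) / 2) = (2 : ℝ) ^ (2 : ℝ) * Real.sqrt 2 := by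
      rw [Real.sqrt_eq_rpow, ← Real.rpow_add (by norm_num)]; norm_num
    rw [h22, show (2 : ℝ) ^ (2 : ℝ) = 4 by norm_num]
    linarith
  rw [hN]
  calc (2 : ℝ) ^ (p.Lg : ℝ) ≤ (2 : ℝ) ^ (((p.E : ℝ)⁻¹ + 1 / 2) * p.n + 5 / 2) :=
        Real.rpow_le_rpow_of_exponent_le (by norm_num) hLgr
    _ = (2 : ℝ) ^ ((5 : ℝ) / 2) * (2 : ℝ) ^ (((p.E : ℝ)⁻¹ + 1 / 2) * p.n) := by
        rw [← Real.rpow_add (by norm_num)]; ring_nf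
    _ ≤ 6 * (2 : ℝ) ^ (((p.E : ℝ)⁻¹ + 1 / 2) * p.n) := by gcongr

/-- `H ≤ 2 · 2^{n/2}`. [folklore] -/
theorem H_real_le : (p.H : ℝ) ≤ 2 * (2 : ℝ) ^ ((1 / 2 : ℝ) * p.n) := by
  obtain ⟨-, -, -, -, -, -, hHeq, -, -⟩ := p.small_facts
  have hhr : (p.hh : ℝ) ≤ ((p.n : ℝ) + 1) / 2 := by
    unfold hh
    calc (((p.n + 1) / 2 : ℕ) : ℝ) ≤ ((p.n + 1 : ℕ) : ℝ) / 2 := Nat.cast_div_le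
      _ = ((p.n : ℝ) + 1) / 2 := by push_cast; ring
  have hH : (p.H : ℝ) = (2 : ℝ) ^ (p.hh : ℝ) := by rw [hHeq]; push_cast; rw [Real.rpow_natCast]
  rw [hH]
  calc (2 : ℝ) ^ (p.hh : ℝ) ≤ (2 : ℝ) ^ (((p.n : ℝ) + 1) / 2) := Real.rpow_le_rpow_of_exponent_le (by norm_num) hhr
    _ = (2 : ℝ) ^ ((1 : ℝ) / 2) * (2 : ℝ) ^ ((1 / 2 : ℝ) * p.n) := by rw [← Real.rpow_add (by norm_num)]; ring_nf
    _ ≤ 2 * (2 : ℝ) ^ ((1 / 2 : ℝ) * p.n) := by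
        gcongr
        calc (2 : ℝ) ^ ((1 : ℝ) / 2) ≤ (2 : ℝ) ^ (1 : ℝ) := Real.rpow_le_rpow_of_exponent_le (by norm_num) (by norm_num)
          _ = 2 := Real.rpow_one _

/-- The scale, in real terms. [folklore] -/
theorem P_real : ((p.P : ℕ) : ℝ) = 2 ^ (p.k + 3) * ((p.n : ℝ) + 1) ^ (p.k + 3) := by
  unfold P scaleP; push_cast; rw [mul_pow]

/-- **The running time of the program, in real terms**: `O(2^{(1-ε/8) n})` for sparsification exponent
`1/E ≤ ε/8`, OV exponent `2 - ε`, `0 < ε ≤ 1`. [folklore] -/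
theorem Ttotal_real_le (hw : p.φ.IsWidthLE p.k) (hnd : p.φ.Nodup) {ε : ℝ} (hε : 0 < ε) (hε1 : ε ≤ 1)
    (hE : 8 / ε ≤ p.E) (hFs : (p.Fs.length : ℝ) ≤ (2 : ℝ) ^ ((p.E : ℝ)⁻¹ * p.n)) {ct : ℕ}
    (hT' : (p.T' : ℝ) ≤ ct * (2 : ℝ) ^ ((p.E : ℝ)⁻¹ * p.n) * ((p.Y : ℝ) + 1) ^ ct)
    {T : ℕ} {Cov : ℝ} (hCov : 0 ≤ Cov) (hT : (T : ℝ) ≤ Cov * (p.N : ℝ) ^ (2 - ε) + Cov)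
    {C₁ : ℝ} (hC₁0 : 0 ≤ C₁) (hC₁ : ((p.n : ℝ) + 1) ^ ((p.k + 3) * (ct + 1)) ≤ C₁ * (2 : ℝ) ^ (ε / 8 * p.n)) :
    ((p.Ttotal p.k T : ℕ) : ℝ) ≤ p.Kreal ct Cov C₁ * (2 : ℝ) ^ ((1 - ε / 8) * p.n) + p.Kreal ct Cov C₁ := by
  have hTpre := p.Tpre_le hw hnd
  obtain ⟨hL, hY, -⟩ := kSAT_size_bounds hw hnd (icodes p.M)
  have hY₀ : p.Y + 1 ≤ (p.k + 5) * p.P := hY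
  have hn0 : (0 : ℝ) ≤ p.n := Nat.cast_nonneg _
  have hE0 : (0 : ℝ) < p.E := lt_of_lt_of_le (by positivity) hE
  have hE8 : (p.E : ℝ)⁻¹ ≤ ε / 8 := by
    rw [inv_le_comm₀ hE0 (by positivity)]
    calc (ε / 8)⁻¹ = 8 / ε := by rw [inv_div]
      _ ≤ p.E := hE
  -- opaque abbreviations
  obtain ⟨Q, hQ⟩ : ∃ Q : ℕ, Q = (p.k + 3) * (ct + 1) := ⟨_, rfl⟩
  obtain ⟨Pq, hPq⟩ : ∃ Pq : ℝ, Pq = ((p.n : ℝ) + 1) ^ Q := ⟨_, rfl⟩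
  obtain ⟨X, hX⟩ : ∃ X : ℝ, X = (2 : ℝ) ^ ((1 - ε / 4) * p.n) := ⟨_, rfl⟩
  rw [← hQ] at hC₁
  have hn1 : (1 : ℝ) ≤ (p.n : ℝ) + 1 := by linarith
  have hPq1 : 1 ≤ Pq := by rw [hPq]; exact one_le_pow₀ hn1
  have hX1 : 1 ≤ X := by rw [hX]; exact Real.one_le_rpow (by norm_num) (mul_nonneg (by linarith) hn0)
  have hX0 : 0 < X := by linarith
  have hPq0 : 0 < Pq := by linarith
  -- exponent comparisons
  have hexp1 : (p.E : ℝ)⁻¹ ≤ 1 - ε / 4 := by linarith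
  have hexp2 : (p.E : ℝ)⁻¹ + 1 / 2 ≤ 1 - ε / 4 := by linarith
  have hexp3 : (2 - ε) * ((p.E : ℝ)⁻¹ + 1 / 2) ≤ 1 - ε / 4 := by
    have h1 : 0 ≤ ε * (p.E : ℝ)⁻¹ := mul_nonneg hε.le (inv_nonneg.2 hE0.le)
    have e : (2 - ε) * ((p.E : ℝ)⁻¹ + 1 / 2) = 2 * (p.E : ℝ)⁻¹ + 1 - ε * (p.E : ℝ)⁻¹ - ε / 2 := by ring
    rw [e]; linarith
  have mono : ∀ {a b : ℝ}, a ≤ b → (2 : ℝ) ^ (a * p.n) ≤ (2 : ℝ) ^ (b * p.n) := fun h =>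
    Real.rpow_le_rpow_of_exponent_le (by norm_num) (mul_le_mul_of_nonneg_right h hn0)
  have h2E : (2 : ℝ) ^ ((p.E : ℝ)⁻¹ * p.n) ≤ X := by rw [hX]; exact mono hexp1
  -- the scale
  have hPr := p.P_real
  have hpowQ : ∀ {a : ℕ}, a ≤ Q → ((p.n : ℝ) + 1) ^ a ≤ Pq := fun h => by rw [hPq]; exact pow_le_pow_right₀ hn1 h
  have hkQ : p.k + 3 ≤ Q := by rw [hQ]; exact Nat.le_mul_of_pos_right _ (Nat.succ_pos _)
  have hctQ : (p.k + 3) * ct ≤ Q := by rw [hQ]; exact Nat.mul_le_mul_left _ (Nat.le_succ _)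
  have h2Q : 2 ≤ Q := by
    rw [hQ]; exact le_trans (by norm_num : 2 ≤ 3 * 1) (Nat.mul_le_mul (by omega) (by omega))
  have hPle : ((p.P : ℕ) : ℝ) ≤ 2 ^ (p.k + 3) * Pq := by
    rw [hPr]; exact mul_le_mul_of_nonneg_left (hpowQ hkQ) (by positivity)
  have hPct : ((p.P : ℕ) : ℝ) ^ ct ≤ 2 ^ ((p.k + 3) * ct) * Pq := by
    rw [hPr, mul_pow, ← pow_mul, ← pow_mul]
    exact mul_le_mul_of_nonneg_left (hpowQ hctQ) (by positivity)
  -- `N`, `H`, `|Fs| H`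
  have hNr := p.N_real_le hE0
  have hNX : (p.N : ℝ) ≤ 6 * X := by rw [hX]; exact hNr.trans (mul_le_mul_of_nonneg_left (mono hexp2) (by norm_num))
  have hHr := p.H_real_le
  have hFsH : (p.Fs.length : ℝ) * p.H ≤ 2 * X := by
    calc (p.Fs.length : ℝ) * p.H ≤ (2 : ℝ) ^ ((p.E : ℝ)⁻¹ * p.n) * (2 * (2 : ℝ) ^ ((1 / 2 : ℝ) * p.n)) :=
          mul_le_mul hFs hHr (Nat.cast_nonneg _) (by positivity)
      _ = 2 * (2 : ℝ) ^ (((p.E : ℝ)⁻¹ + 1 / 2) * p.n) := by rw [add_mul, Real.rpow_add (by norm_num)]; ring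
      _ ≤ 2 * X := by rw [hX]; exact mul_le_mul_of_nonneg_left (mono hexp2) (by norm_num)
  have hNpow : (p.N : ℝ) ^ (2 - ε) ≤ 36 * X := by
    have hε2 : 0 ≤ 2 - ε := by linarith
    calc (p.N : ℝ) ^ (2 - ε) ≤ (6 * (2 : ℝ) ^ (((p.E : ℝ)⁻¹ + 1 / 2) * p.n)) ^ (2 - ε) :=
          Real.rpow_le_rpow (Nat.cast_nonneg _) hNr hε2
      _ = (6 : ℝ) ^ (2 - ε) * (2 : ℝ) ^ ((2 - ε) * ((p.E : ℝ)⁻¹ + 1 / 2) * p.n) := by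
          rw [Real.mul_rpow (by norm_num) (by positivity), ← Real.rpow_mul (by norm_num)]; ring_nf
      _ ≤ 36 * X := by
          rw [hX]
          refine mul_le_mul ?_ (mono hexp3) (by positivity) (by norm_num)
          calc (6 : ℝ) ^ (2 - ε) ≤ (6 : ℝ) ^ (2 : ℝ) := Real.rpow_le_rpow_of_exponent_le (by norm_num) (by linarith)
            _ = 36 := by norm_num
  -- the nat bound, cast
  obtain ⟨sc, hsc⟩ : ∃ sc : ℝ, sc = (((TM2Emu.enc p.M.tm).stepCost p.M.tm.m : ℕ) : ℝ) + 2 := ⟨_, rfl⟩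
  have hsc0 : 0 ≤ sc := by rw [hsc]; positivity
  obtain ⟨KF, hKF⟩ : ∃ KF : ℝ, KF = ((p.Cs : ℝ) + 1) * (44 * (p.k : ℝ) + 65) := ⟨_, rfl⟩
  have hKF0 : 0 ≤ KF := by rw [hKF]; positivity
  have hcs : ((cstep : ℕ) : ℝ) = 38 := by norm_num [cstep]
  have hcast : ((p.Ttotal p.k T : ℕ) : ℝ) ≤ (p.Kpoly : ℝ) * p.P + p.T' * sc +
      p.N * ((17 * p.E + 37) * ((p.n : ℝ) + 1)) + p.Fs.length * (KF * ((p.n : ℝ) + 1) ^ 2 * p.H) + 38 * T + 4 := by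
    have h := (Nat.cast_le (α := ℝ)).2 hTpre
    have e : ((p.Ttotal p.k T : ℕ) : ℝ) = (p.Tpre p.k : ℝ) + 38 * T + 4 := by
      unfold Ttotal; push_cast; rw [hcs]
    rw [e, hsc, hKF]
    push_cast at h ⊢
    linarith
  -- the four build terms and the run
  have t1 : (p.Kpoly : ℝ) * p.P ≤ (p.Kpoly : ℝ) * 2 ^ (p.k + 3) * (Pq * X) := by
    calc (p.Kpoly : ℝ) * p.P ≤ p.Kpoly * (2 ^ (p.k + 3) * Pq) := mul_le_mul_of_nonneg_left hPle (Nat.cast_nonneg _)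
      _ = (p.Kpoly : ℝ) * 2 ^ (p.k + 3) * (Pq * 1) := by ring
      _ ≤ (p.Kpoly : ℝ) * 2 ^ (p.k + 3) * (Pq * X) := by gcongr
  have t2 : (p.T' : ℝ) * sc ≤ sc * ct * ((p.k : ℝ) + 5) ^ ct * 2 ^ ((p.k + 3) * ct) * (Pq * X) := by
    have hY1 : (p.Y : ℝ) + 1 ≤ ((p.k : ℝ) + 5) * p.P := by
      have : ((p.Y + 1 : ℕ) : ℝ) ≤ (((p.k + 5) * p.P : ℕ) : ℝ) := by exact_mod_cast hY₀
      push_cast at this; linarith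
    calc (p.T' : ℝ) * sc ≤ (ct * (2 : ℝ) ^ ((p.E : ℝ)⁻¹ * p.n) * ((p.Y : ℝ) + 1) ^ ct) * sc :=
          mul_le_mul_of_nonneg_right hT' hsc0
      _ ≤ (ct * X * (((p.k : ℝ) + 5) * p.P) ^ ct) * sc := by gcongr
      _ = sc * ct * ((p.k : ℝ) + 5) ^ ct * ((p.P : ℝ) ^ ct) * X := by rw [mul_pow]; ring
      _ ≤ sc * ct * ((p.k : ℝ) + 5) ^ ct * (2 ^ ((p.k + 3) * ct) * Pq) * X := by gcongr
      _ = sc * ct * ((p.k : ℝ) + 5) ^ ct * 2 ^ ((p.k + 3) * ct) * (Pq * X) := by ring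
  have t3 : (p.N : ℝ) * ((17 * p.E + 37) * ((p.n : ℝ) + 1)) ≤ 6 * (17 * (p.E : ℝ) + 37) * (Pq * X) := by
    have hn1Q : ((p.n : ℝ) + 1) ≤ Pq := by
      calc ((p.n : ℝ) + 1) = ((p.n : ℝ) + 1) ^ 1 := (pow_one _).symm
        _ ≤ Pq := hpowQ (by omega)
    calc (p.N : ℝ) * ((17 * p.E + 37) * ((p.n : ℝ) + 1)) ≤ (6 * X) * ((17 * p.E + 37) * Pq) := by gcongr
      _ = 6 * (17 * (p.E : ℝ) + 37) * (Pq * X) := by ring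
  have t4 : (p.Fs.length : ℝ) * (KF * ((p.n : ℝ) + 1) ^ 2 * p.H) ≤ 2 * KF * (Pq * X) := by
    have hn2Q : ((p.n : ℝ) + 1) ^ 2 ≤ Pq := hpowQ h2Q
    calc (p.Fs.length : ℝ) * (KF * ((p.n : ℝ) + 1) ^ 2 * p.H)
          = KF * ((p.n : ℝ) + 1) ^ 2 * ((p.Fs.length : ℝ) * p.H) := by ring
      _ ≤ KF * Pq * (2 * X) := by gcongr
      _ = 2 * KF * (Pq * X) := by ring
  have t5 : 38 * (T : ℝ) ≤ 1368 * Cov * (Pq * X) + 38 * Cov := by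
    calc 38 * (T : ℝ) ≤ 38 * (Cov * (p.N : ℝ) ^ (2 - ε) + Cov) := by gcongr
      _ ≤ 38 * (Cov * (36 * X) + Cov) := by gcongr
      _ = 1368 * Cov * (1 * X) + 38 * Cov := by ring
      _ ≤ 1368 * Cov * (Pq * X) + 38 * Cov := by gcongr
  -- `Pq · X ≤ C₁ 2^{(1-ε/8)n}`
  have hPX : Pq * X ≤ C₁ * (2 : ℝ) ^ ((1 - ε / 8) * p.n) := by
    rw [hPq, hX]
    calc ((p.n : ℝ) + 1) ^ Q * (2 : ℝ) ^ ((1 - ε / 4) * p.n)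
          ≤ (C₁ * (2 : ℝ) ^ (ε / 8 * p.n)) * (2 : ℝ) ^ ((1 - ε / 4) * p.n) :=
          mul_le_mul_of_nonneg_right hC₁ (by positivity)
      _ = C₁ * ((2 : ℝ) ^ (ε / 8 * p.n) * (2 : ℝ) ^ ((1 - ε / 4) * p.n)) := by ring
      _ = C₁ * (2 : ℝ) ^ ((1 - ε / 8) * p.n) := by rw [← Real.rpow_add (by norm_num)]; ring_nf
  -- assemble
  obtain ⟨K0, hK0def⟩ : ∃ K0 : ℝ, K0 = (p.Kpoly : ℝ) * 2 ^ (p.k + 3) + sc * ct * ((p.k : ℝ) + 5) ^ ct * 2 ^ ((p.k + 3) * ct) +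
      6 * (17 * (p.E : ℝ) + 37) + 2 * KF + 1368 * Cov := ⟨_, rfl⟩
  have hK0 : 0 ≤ K0 := by rw [hK0def]; positivity
  have hKr : p.Kreal ct Cov C₁ = K0 * C₁ + 38 * Cov + 4 := by
    rw [hK0def, hsc, hKF]; unfold Kreal KrealK Kpoly Ay; push_cast; ring
  have hsum : ((p.Ttotal p.k T : ℕ) : ℝ) ≤ K0 * (Pq * X) + 38 * Cov + 4 := by
    have := add_le_add (add_le_add (add_le_add (add_le_add t1 t2) t3) t4) t5
    calc ((p.Ttotal p.k T : ℕ) : ℝ) ≤ _ := hcast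
      _ ≤ _ := add_le_add this le_rfl
      _ = K0 * (Pq * X) + 38 * Cov + 4 := by rw [hK0def]; ring
  have hpow0 : 0 ≤ (2 : ℝ) ^ ((1 - ε / 8) * p.n) := by positivity
  have hfin : K0 * (Pq * X) ≤ K0 * C₁ * (2 : ℝ) ^ ((1 - ε / 8) * p.n) := by
    rw [mul_assoc]; exact mul_le_mul_of_nonneg_left hPX hK0
  have hKC : 0 ≤ K0 * C₁ := mul_nonneg hK0 hC₁0
  have h1 : K0 * C₁ * (2 : ℝ) ^ ((1 - ε / 8) * p.n) ≤ (K0 * C₁ + 38 * Cov + 4) * (2 : ℝ) ^ ((1 - ε / 8) * p.n) :=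
    mul_le_mul_of_nonneg_right (by linarith) hpow0
  rw [hKr]
  linarith

end Params

/-! ### The named fact -/

/-- `⌈n/E⌉ ≥ n/E` as reals (for `E ≥ 1`). [folklore] -/
theorem div_le_ceilDiv {n E : ℕ} (hE : 1 ≤ E) : (n : ℝ) / E ≤ (((n + (E - 1)) / E : ℕ) : ℝ) := by
  have hE0 : (0 : ℝ) < E := by exact_mod_cast hE
  rw [div_le_iff₀ hE0]
  have : n ≤ (n + (E - 1)) / E * E := by
    have := Nat.div_add_mod (n + (E - 1)) E
    have := Nat.mod_lt (n + (E - 1)) (by omega : 0 < E)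
    have hc : (n + (E - 1)) / E * E = E * ((n + (E - 1)) / E) := Nat.mul_comm _ _
    omega
  exact_mod_cast this

/-- **Williams' split-and-list reduction with sparsification, on the word RAM.** For `0 < ε ≤ 1` and
every `k` there is a dimension constant `c ≥ 1` such that a deterministic `O(n^{2-ε})`-time word-RAM
algorithm for `OVWithDim c` yields a deterministic word-RAM algorithm for `k`-SAT with exponent
`1 - ε/8` (`KSATInRAMTime k (1 - ε/8)`). The program sparsifies with exponent `1/E`, `E = ⌈8/ε⌉`
(Impagliazzo–Paturi–Zane, simulated with constant overhead), builds ONE OV instance for the whole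
disjunction (`2^{⌈n/E⌉+1+⌈n/2⌉}` vectors per side, dimension `c · log N`, `c = 2 C + 3` for the
sparsification density `C`) and runs the OV algorithm once at its own word size.
[cite: WilliamsTCS2005, §5.1 Thm. 5.1] [cite: VassilevskaWilliamsICM2018, §3 Thm. 3.1 (proof)] -/
theorem kSATInRAMTime_of_ovWithDim {ε : ℝ} (hε : 0 < ε) (hε1 : ε ≤ 1) (k : ℕ) :
    ∃ c : ℕ, 1 ≤ c ∧ ((OVWithDim c).InTimeO (fun n => (n : ℝ) ^ (2 - ε)) → KSATInRAMTime k (1 - ε / 8)) := by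
  classical
  -- the sparsification
  set E : ℕ := ⌈8 / ε⌉₊ with hEdef
  have hE8 : 8 / ε ≤ (E : ℝ) := Nat.le_ceil _
  have hE8' : (8 : ℝ) ≤ 8 / ε := by rw [le_div_iff₀ hε]; nlinarith
  have hE1 : 1 ≤ E := by
    have : (1 : ℝ) ≤ E := by linarith
    exact_mod_cast this
  have hεs : 0 < (E : ℝ)⁻¹ := by positivity
  obtain ⟨Cs, Fk, Ts, hFk, ⟨ct, hct⟩, ⟨M, hM⟩⟩ := sparsification_holds k (E : ℝ)⁻¹ hεs
  refine ⟨2 * Cs + 3, by omega, fun hov => ?_⟩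
  obtain ⟨Cov', Mov, kM, hdet, hof, hMov⟩ := hov
  -- the degenerate case
  rcases Nat.eq_zero_or_pos kM with hk0 | hkM
  · subst hk0; exact (not_ov_outputs_at_wordSize_zero (by omega) hMov).elim
  -- constants
  set Cov : ℝ := max Cov' 0 with hCovdef
  have hCov0 : 0 ≤ Cov := le_max_right _ _
  obtain ⟨C₁, hC₁0, hC₁⟩ := exists_pow_le_two_rpow ((k + 3) * (ct + 1)) (ε := ε / 8) (by positivity)
  set cM := Mov.maxConst with hcMdef
  refine ⟨reduction M Mov E Cs (2 * Cs + 3) kM, wmulK k E Cs kM cM M ct, KrealK k E Cs M ct Cov C₁,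
    reduction_isDeterministic M Mov E Cs _ kM, reduction_isOracleFree M Mov E Cs _ kM, fun φ => ?_⟩
  obtain ⟨φ, hwid, hnd⟩ := φ
  -- the parameters of the run
  set p : Params := paramsOf k E Cs kM cM M Fk Ts φ hwid with hpdef
  set φ' : KCNF k := toKCNF k φ hwid with hφ'
  obtain ⟨hlenF, hprops, hequiv⟩ := hFk φ'
  have hpn : p.n = φ.numVars := rfl
  have hpk : p.k = k := rfl
  have hpFs : p.Fs = (Fk φ').map fun ψ => (ψ.numVars, ψ.clauses) := rfl
  have hφ'n : φ'.numVars = φ.numVars := rfl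
  -- the formulas on the tape
  have hf1 : ∀ f ∈ p.Fs, f.1 ≤ p.n := fun f hf => by
    rw [hpFs] at hf; obtain ⟨ψ, hψ, rfl⟩ := List.mem_map.1 hf
    exact le_of_eq ((hprops ψ hψ).1.trans hφ'n)
  have hfD : ∀ f ∈ p.Fs, f.2.length ≤ p.D := fun f hf => by
    rw [hpFs] at hf; obtain ⟨ψ, hψ, rfl⟩ := List.mem_map.1 hf
    have := (hprops ψ hψ).2
    show ψ.clauses.length ≤ φ.numVars * Cs
    rw [hφ'n] at this; rw [Nat.mul_comm]; exact this
  have hvars : ∀ f ∈ p.Fs, ∀ C ∈ f.2, ∀ l ∈ C, l.1 < p.n := fun f hf C hC l hl => by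
    rw [hpFs] at hf; obtain ⟨ψ, hψ, rfl⟩ := List.mem_map.1 hf
    have := ψ.fst_lt_numVars C hC l hl
    rw [(hprops ψ hψ).1, hφ'n] at this; exact this
  have hkw : ∀ f ∈ p.Fs, ∀ C ∈ f.2, C.length ≤ k := fun f hf C hC => by
    rw [hpFs] at hf; obtain ⟨ψ, hψ, rfl⟩ := List.mem_map.1 hf
    exact ψ.length_le C hC
  have hFslen : p.Fs.length = (Fk φ').length := by rw [hpFs, List.length_map]
  have hFs_real : (p.Fs.length : ℝ) ≤ (2 : ℝ) ^ ((E : ℝ)⁻¹ * p.n) := by rw [hFslen, hpn, ← hφ'n]; exact hlenF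
  have hFs_nat : p.Fs.length ≤ 2 ^ (p.ℓ - 1) := by
    have h1 : (E : ℝ)⁻¹ * p.n ≤ ((p.ℓ - 1 : ℕ) : ℝ) := by
      show (E : ℝ)⁻¹ * (φ.numVars : ℝ) ≤ (((φ.numVars + (E - 1)) / E + 1 - 1 : ℕ) : ℝ)
      rw [Nat.add_sub_cancel, inv_mul_eq_div]
      exact div_le_ceilDiv hE1
    have : (p.Fs.length : ℝ) ≤ ((2 ^ (p.ℓ - 1) : ℕ) : ℝ) := by
      calc (p.Fs.length : ℝ) ≤ (2 : ℝ) ^ ((E : ℝ)⁻¹ * p.n) := hFs_real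
        _ ≤ (2 : ℝ) ^ (((p.ℓ - 1 : ℕ) : ℝ)) := Real.rpow_le_rpow_of_exponent_le (by norm_num) h1
        _ = ((2 ^ (p.ℓ - 1) : ℕ) : ℝ) := by rw [Real.rpow_natCast]; push_cast; ring
    exact_mod_cast this
  obtain ⟨hℓ1, hLg1, hN1, hHN, hd1, hc3, hHeq, hNeq, hLgeq⟩ := p.small_facts
  have hrows : p.Fs.length * p.H ≤ p.N := by
    rw [hNeq, hLgeq, Nat.pow_add, ← hHeq]
    exact Nat.mul_le_mul_right _ (hFs_nat.trans (Nat.pow_le_pow_right (by norm_num) (Nat.sub_le _ _)))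
  -- the machine's run
  have hout : p.out = KCNF.encodeList (Fk φ') := by
    show sAll p.Fs = _; rw [hpFs, encodeList_eq_sAll]
  have hrun : Nonempty (TM2OutputsInTime M.tm (p.inp hwid) (some p.out') p.T') := by
    have := hM φ'
    unfold Params.out' Params.inp; rw [hout]; exact this
  -- the machine's time, as a natural number
  have hYenc : p.Y = φ'.encode.length := (p.Y_eq hwid).trans (List.length_map _)
  have hT'r : (p.T' : ℝ) ≤ ct * (2 : ℝ) ^ ((E : ℝ)⁻¹ * p.n) * ((p.Y : ℝ) + 1) ^ ct := by
    have := hct φ.numVars φ'.encode.length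
    rw [hYenc]; exact this
  have hT'n : p.T' ≤ ct * 2 ^ (1 * p.n) * (p.Y + 1) ^ ct := by
    have h2 : (2 : ℝ) ^ ((E : ℝ)⁻¹ * p.n) ≤ (2 : ℝ) ^ ((1 : ℝ) * p.n) := by
      refine Real.rpow_le_rpow_of_exponent_le (by norm_num) (mul_le_mul_of_nonneg_right ?_ (Nat.cast_nonneg _))
      exact inv_le_one_of_one_le₀ (by exact_mod_cast hE1)
    have h3 : (2 : ℝ) ^ ((1 : ℝ) * p.n) = ((2 ^ (1 * p.n) : ℕ) : ℝ) := by
      rw [one_mul, Nat.one_mul, Real.rpow_natCast]; push_cast; rfl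
    have : (p.T' : ℝ) ≤ ((ct * 2 ^ (1 * p.n) * (p.Y + 1) ^ ct : ℕ) : ℝ) := by
      calc (p.T' : ℝ) ≤ ct * (2 : ℝ) ^ ((E : ℝ)⁻¹ * p.n) * ((p.Y : ℝ) + 1) ^ ct := hT'r
        _ ≤ ct * (2 : ℝ) ^ ((1 : ℝ) * p.n) * ((p.Y : ℝ) + 1) ^ ct := by gcongr
        _ = _ := by rw [h3]; push_cast; ring
    exact_mod_cast this
  -- the output length
  have houtlen : p.out.length ≤ 2 ^ p.n * ((2 + 2 * p.Cs + 3 * p.Cs * p.k) * (p.n + 1) ^ 2) := by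
    have h1 := length_sAll_le (k := k) (C := Cs) (n := φ.numVars) (Fk φ') (fun ψ hψ => (hprops ψ hψ).1.trans hφ'n)
      (fun ψ hψ => by have := (hprops ψ hψ).2; rw [hφ'n] at this; exact this)
    have h2 : (Fk φ').length ≤ 2 ^ p.n := by
      rw [← hFslen]; exact hFs_nat.trans (Nat.pow_le_pow_right (by norm_num) (p.ℓ_hh_Lg_le.2.1 hE1))
    show (sAll p.Fs).length ≤ _
    rw [hpFs]
    exact h1.trans (Nat.mul_le_mul_right _ h2)
  -- the word size
  have hFits := p.fits hwid hnd hT'n houtlen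
  set W := p.wmul ct * (p.n + inputWidth p.x) with hWdef
  -- the OV instance and the OV program's run
  have hlog : p.d = (2 * Cs + 3) * Nat.log 2 p.N := by
    rw [hNeq, Nat.log_pow (by norm_num)]; show p.Lg * p.c = _; rw [Nat.mul_comm]; rfl
  let I : (OVWithDim (2 * Cs + 3)).Inst := ⟨ovInst p.F p.hh p.H p.D p.ℓ p.N p.d, hlog⟩
  have hsat : I.1.HasOrthogonalPair ↔ φ.Satisfiable := by
    have key := hasOrthogonalPair_ovInst_iff (F := p.F) (h := p.hh) (H := p.H) (D := p.D) (ℓ := p.ℓ)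
      (n := p.n) (N := p.N) (d := p.d) hHeq
      (hFs_nat.trans (Nat.pow_le_pow_right (by norm_num) (Nat.sub_le _ _)) |> fun h => by
        show p.F.length ≤ 2 ^ p.ℓ; unfold Params.F; rw [List.length_map]; exact h)
      (by rw [hNeq, hLgeq, Nat.pow_add, hHeq])
      (fun ψ hψ => by
        unfold Params.F at hψ; obtain ⟨f, hf, rfl⟩ := List.mem_map.1 hψ; exact hfD f hf)
      (fun ψ hψ C hC l hl => by
        unfold Params.F at hψ; obtain ⟨f, hf, rfl⟩ := List.mem_map.1 hψ; exact hvars f hf C hC l hl)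
      p.n_le_two_hh (by have := p.EX_lt_d; omega)
    rw [show I.1 = ovInst p.F p.hh p.H p.D p.ℓ p.N p.d from rfl, key]
    -- through the sparsification equivalence
    rw [← toKCNF_satisfiable_iff φ hwid, KCNF.satisfiable_iff_exists_eval]
    constructor
    · rintro ⟨ψ, hψ, v, hv⟩
      unfold Params.F at hψ; rw [hpFs, List.map_map] at hψ
      obtain ⟨ψ', hψ', rfl⟩ := List.mem_map.1 hψ
      exact ⟨v, (hequiv v).2 ⟨ψ', hψ', hv⟩⟩
    · rintro ⟨v, hv⟩
      obtain ⟨ψ', hψ', hv'⟩ := (hequiv v).1 hv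
      refine ⟨ψ'.clauses, ?_, v, hv'⟩
      unfold Params.F; rw [hpFs, List.map_map]
      exact List.mem_map.2 ⟨ψ', hψ', rfl⟩
  obtain ⟨outv, hgood, hrunov⟩ := hMov I
  have hbit : outv = [if φ.Satisfiable then 1 else 0] := by
    by_cases hs : φ.Satisfiable
    · have : (OVWithDim (2 * Cs + 3)).Good I = {[1]} := FGProblem.ofPred_good_of_pos _ _ _ _ (hsat.2 hs)
      rw [this, Set.mem_singleton_iff] at hgood; rw [hgood, if_pos hs]
    · have : (OVWithDim (2 * Cs + 3)).Good I = {[0]} := FGProblem.ofPred_good_of_neg _ _ _ _ (fun h => hs (hsat.1 h))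
      rw [this, Set.mem_singleton_iff] at hgood; rw [hgood, if_neg hs]
  have hwsI : kM * (OVWithDim (2 * Cs + 3)).width I = p.ws := by
    show kM * inputWidth p.y = p.szy * p.kM
    rw [p.inputWidth_y, Nat.mul_comm]; rfl
  rw [hwsI, hbit] at hrunov
  change OutputsWithin Mov p.ws noOracle zeroCoins p.y [if φ.Satisfiable then 1 else 0]
    ⌊Cov' * ((p.N : ℕ) : ℝ) ^ (2 - ε) + Cov'⌋₊ at hrunov
  -- the program's run
  have hred := p.reduction_outputsWithin hFits hkM hwid hrun hf1 hfD hvars hkw hrows hdet hof rfl hrunov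
  refine ⟨_, (kSATProblem_good_iff ⟨φ, hwid, hnd⟩ _).2 rfl, ?_⟩
  change OutputsWithin (reduction M Mov E Cs (2 * Cs + 3) kM) W noOracle zeroCoins p.x [if φ.Satisfiable then 1 else 0]
    ⌊KrealK k E Cs M ct Cov C₁ * (2 : ℝ) ^ ((1 - ε / 8) * (φ.numVars : ℝ)) + KrealK k E Cs M ct Cov C₁⌋₊
  refine hred.mono (Nat.le_floor ?_)
  -- the time bound
  have hTov : ((⌊Cov' * ((p.N : ℕ) : ℝ) ^ (2 - ε) + Cov'⌋₊ : ℕ) : ℝ) ≤ Cov * (p.N : ℝ) ^ (2 - ε) + Cov := by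
    refine (natFloor_le_max _).trans (max_le ?_ (by positivity))
    have h1 : Cov' ≤ Cov := le_max_left _ _
    have h2 : 0 ≤ (p.N : ℝ) ^ (2 - ε) := by positivity
    nlinarith
  have := p.Ttotal_real_le hwid hnd hε hε1 hE8 hFs_real hT'r hCov0 hTov hC₁0 (hC₁ p.n)
  exact this

/-- **fine-grained.S09, discharged** (R. Williams, *A new algorithm for optimal 2-constraint
satisfaction and its implications*, TCS 348 (2005), §5.1, Thm. 5.1 — Theorem 5 of the author's version;
V. Vassilevska Williams, Proc. ICM 2018, §3, Thm. 3.1: word-RAM SETH implies the deterministic OV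
conjecture). If for some `ε > 0` OV in dimension `c log n` had an `O(n^{2-ε})` word-RAM algorithm for
every `c ≥ 1`, then (shrinking `ε` below `1`) every `k`-SAT would be in word-RAM time
`O(2^{(1-ε/8)n})` by `kSATInRAMTime_of_ovWithDim`, contradicting word-RAM SETH at `ε/8`.
[cite: WilliamsTCS2005, §5.1 Thm. 5.1] [cite: VassilevskaWilliamsICM2018, §3 Thm. 3.1] -/
theorem _root_.Literature.Computability.FineGrained.ovConjectureDet_of_sethWordRAM_holds :
    ovConjectureDet_of_sethWordRAM := by
  intro hSETH ε hε
  by_contra hno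
  push Not at hno
  set ε₁ : ℝ := min ε 1 with hε₁
  have hε₁pos : 0 < ε₁ := lt_min hε one_pos
  have hε₁le : ε₁ ≤ 1 := min_le_right _ _
  obtain ⟨k, -, hk⟩ := hSETH (ε₁ / 8) (by positivity)
  obtain ⟨c, hc1, himp⟩ := kSATInRAMTime_of_ovWithDim hε₁pos hε₁le k
  have hov : (OVWithDim c).InTimeO fun n => (n : ℝ) ^ (2 - ε₁) :=
    inTimeO_rpow_two_sub_anti (min_le_left _ _) (hno c hc1)
  have := himp hov
  exact hk this

end Literature.Computability.FineGrained.OVRed.Single
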